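import Mathlib

/-!
# Finitely many zeros of a power series over a complete local ring at topologically nilpotent points —
the Weierstrass item of T3.2 (method (b′)), on Mathlib's Weierstrass preparation and power-series evaluation

Blind re-derivation cell `pub-hodge-repro`, seat `t3-p4` (Tier 3, T3.5 Lean item asked by the Tier-3 lead, STATUS S9690:
«a nonzero power series over a complete DVR has finitely many zeros among the points `ζ − 1`, `ζ` of `ℓ`-power order, of a
finite extension»).  Target tree path `lean/Summits/Ventures/HodgeRepro/Tier3Weierstrass.lean`; Mathlib only.

WHERE IT ENTERS (route/TIER3.md v0.2 §2 T3.2, method (b′)): the anticyclotomic `ℓ`-adic Katz measure pushed to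
`Γ_𝔩 ≅ ℤ_ℓ` is an element `G ∈ O⟦T⟧` (`O` the ring of integers of a finite extension of `ℚ_ℓ`, a complete DVR); a
finite-order character `ν` of `Γ_𝔩` with `ν(γ) = ζ` (an `ℓ`-power root of unity in a finite extension `O′`) evaluates `G`
at `T = ζ − 1`, a topologically nilpotent point of `O′`; ONE `ν₀` with `L(1, λν₀) ≠ 0` makes `G ≠ 0`, and THEN all but
finitely many `ν` have `G(ζ − 1) ≠ 0`.  The «then» is this file.

* `PowerSeries.finite_zeros_of_map_residue_ne_zero` — `A` a complete local ring, `B` a complete separated linearly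
  topologised domain and `A`-algebra, `g ∈ A⟦X⟧` with non-zero image in the residue field: the set of topologically
  nilpotent `x ∈ B` with `g(x) = 0` is finite.  Proof: Weierstrass preparation `g = f · h` (`f` distinguished, `h` a unit
  — Mathlib `PowerSeries.exists_isWeierstrassFactorization`, [washington_cyclotomic] Thm 7.3), evaluation is an algebra
  homomorphism (`PowerSeries.aeval`), so `g(x) = f(x) · h(x)` with `h(x)` a unit, and `f` is a non-zero (monic) polynomial
  with finitely many roots in the domain `B`.
* `PowerSeries.exists_smul_eq_of_ne_zero` — over a discrete valuation ring, `0 ≠ g = ϖ^μ • g′` with `g′` of non-zero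
  residue image (`μ` = the least coefficient valuation), and
* `PowerSeries.finite_zeros_of_ne_zero` — the DVR form: `0 ≠ g ∈ A⟦X⟧`, `algebraMap A B` injective ⇒ finitely many
  topologically nilpotent zeros in `B`;
* `PowerSeries.finite_rootsOfUnity_zeros_of_ne_zero` — the form the lead asked for: finitely many `ζ` (in any set, e.g. the
  `ℓ`-power roots of unity of `B`) with `ζ − 1` topologically nilpotent and `g(ζ − 1) = 0`.

HONESTY.  These are statements of commutative algebra on Mathlib; nothing here is about Hecke characters or `L`-values
— the identification of `G` with a Katz measure and of `G(ζ − 1)` with an `L`-value is T3.2's (printed interpolation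
formula), not this file's.  Nothing here says anything about the status of the Hodge conjecture for CM abelian
varieties, which is NOT proved.
-/

set_option autoImplicit false

open Polynomial

namespace PowerSeries

section CompleteLocal

variable {A : Type*} [CommRing A] [IsLocalRing A] [IsAdicComplete (IsLocalRing.maximalIdeal A) A]
  [UniformSpace A] [IsUniformAddGroup A] [IsTopologicalRing A]
variable {B : Type*} [CommRing B] [IsDomain B] [UniformSpace B] [IsUniformAddGroup B] [T2Space B]
  [CompleteSpace B] [IsTopologicalRing B] [IsLinearTopology B B] [Algebra A B] [ContinuousSMul A B]

omit [IsLocalRing A] [IsAdicComplete (IsLocalRing.maximalIdeal A) A] in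
/-- **The zero set of a power series with non-zero residue image is contained in the root set of its Weierstrass
polynomial**: if `g = f · h` with `f : A[X]` and `h` a unit of `A⟦X⟧`, then every topologically nilpotent `x ∈ B` with
`g(x) = 0` is a root of `f.map (algebraMap A B)`. -/
theorem isRoot_map_of_aeval_eq_zero {g : PowerSeries A} {f : A[X]} {h : PowerSeries A}
    (hf : g = (f : PowerSeries A) * h) (hh : IsUnit h) {x : B} (hx : HasEval x)
    (h0 : aeval hx g = 0) : (f.map (algebraMap A B)).IsRoot x := by
  have h1 : aeval hx g = Polynomial.aeval x f * aeval hx h := by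
    rw [hf, map_mul, aeval_coe]
  have hu : IsUnit (aeval hx h) := hh.map (aeval hx)
  rw [h1] at h0
  rw [IsRoot.def, eval_map_algebraMap]
  exact (mul_eq_zero.mp h0).resolve_right hu.ne_zero

/-- **Finitely many zeros** (the Weierstrass item): for `g ∈ A⟦X⟧` with non-zero image in the residue field of the
complete local ring `A`, the topologically nilpotent points `x` of the complete linearly topologised domain `B` at which
`g` vanishes form a finite set. -/
theorem finite_zeros_of_map_residue_ne_zero (g : PowerSeries A)
    (hg : g.map (IsLocalRing.residue A) ≠ 0) :
    {x : B | ∃ hx : HasEval x, aeval hx g = 0}.Finite := by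
  obtain ⟨f, h, H⟩ := g.exists_isWeierstrassFactorization hg
  have hfne : f.map (algebraMap A B) ≠ 0 :=
    (H.isDistinguishedAt.monic.map (algebraMap A B)).ne_zero
  refine (Polynomial.finite_setOf_isRoot hfne).subset ?_
  rintro x ⟨hx, h0⟩
  exact isRoot_map_of_aeval_eq_zero H.eq_mul H.isUnit hx h0

end CompleteLocal

section DVR

variable {A : Type*} [CommRing A] [IsDomain A] [IsDiscreteValuationRing A]

/-- **Extracting the uniformiser power**: a non-zero power series over a discrete valuation ring is `ϖ^μ • g′` with
`g′` of non-zero image in the residue field (`μ` = the least valuation of a coefficient). -/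
theorem exists_smul_eq_of_ne_zero {ϖ : A} (hϖ : Irreducible ϖ) {g : PowerSeries A} (hg : g ≠ 0) :
    ∃ (μ : ℕ) (g' : PowerSeries A), g = ϖ ^ μ • g' ∧ g'.map (IsLocalRing.residue A) ≠ 0 := by
  classical
  -- the predicate «ϖ^k divides every coefficient»
  have hP0 : ∀ n, ϖ ^ 0 ∣ coeff n g := fun n => by simp
  obtain ⟨n₀, hn₀⟩ : ∃ n, coeff n g ≠ 0 := by
    by_contra hcon
    exact hg (PowerSeries.ext fun n => by simpa using not_not.mp (not_exists.mp hcon n))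
  -- only finitely many powers of ϖ divide the non-zero coefficient `coeff n₀ g`
  obtain ⟨N, hN⟩ : ∃ N, ¬ ϖ ^ N ∣ coeff n₀ g := by
    obtain ⟨m, u, hmu⟩ := IsDiscreteValuationRing.eq_unit_mul_pow_irreducible hn₀ hϖ
    refine ⟨m + 1, fun hdvd => ?_⟩
    rw [hmu] at hdvd
    have h1 : ϖ ^ (m + 1) ∣ ϖ ^ m := (Units.isUnit u).dvd_mul_left.mp hdvd
    have h2 := (pow_dvd_pow_iff hϖ.ne_zero hϖ.not_isUnit).mp h1
    omega
  -- μ := the least k with «ϖ^(k+1) does not divide every coefficient»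
  have hex : ∃ k, ¬ ∀ n, ϖ ^ (k + 1) ∣ coeff n g := ⟨N, fun h => hN ((pow_dvd_pow ϖ (by omega)).trans (h n₀))⟩
  let μ := Nat.find hex
  have hμ : ¬ ∀ n, ϖ ^ (μ + 1) ∣ coeff n g := Nat.find_spec hex
  have hμall : ∀ n, ϖ ^ μ ∣ coeff n g := by
    rcases Nat.eq_zero_or_pos μ with h | h
    · rw [h]; exact hP0
    · have hmin := Nat.find_min hex (Nat.sub_one_lt_of_lt h)
      have hμ' : μ - 1 + 1 = μ := Nat.sub_add_cancel h
      rw [hμ'] at hmin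
      exact not_not.mp hmin
  choose c hc using hμall
  refine ⟨μ, PowerSeries.mk c, PowerSeries.ext fun n => ?_, fun hzero => hμ fun n => ?_⟩
  · simp [hc n]
  · have : IsLocalRing.residue A (c n) = 0 := by
      have := congrArg (coeff n) hzero
      simpa using this
    rw [IsLocalRing.residue_eq_zero_iff, hϖ.maximalIdeal_eq,
      Ideal.mem_span_singleton] at this
    rw [hc n, pow_succ]
    exact mul_dvd_mul_left _ this

variable [IsAdicComplete (IsLocalRing.maximalIdeal A) A] [UniformSpace A] [IsUniformAddGroup A]
  [IsTopologicalRing A]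
variable {B : Type*} [CommRing B] [IsDomain B] [UniformSpace B] [IsUniformAddGroup B] [T2Space B]
  [CompleteSpace B] [IsTopologicalRing B] [IsLinearTopology B B] [Algebra A B] [ContinuousSMul A B]

/-- **Finitely many zeros, DVR form**: a non-zero power series over a complete discrete valuation ring `A` has finitely
many zeros among the topologically nilpotent points of a complete linearly topologised domain `B` into which `A` injects. -/
theorem finite_zeros_of_ne_zero (hinj : Function.Injective (algebraMap A B)) {g : PowerSeries A}
    (hg : g ≠ 0) : {x : B | ∃ hx : HasEval x, aeval hx g = 0}.Finite := by
  obtain ⟨ϖ, hϖ⟩ := IsDiscreteValuationRing.exists_irreducible A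
  obtain ⟨μ, g', rfl, hg'⟩ := exists_smul_eq_of_ne_zero hϖ hg
  refine (finite_zeros_of_map_residue_ne_zero (B := B) g' hg').subset ?_
  rintro x ⟨hx, h0⟩
  refine ⟨hx, ?_⟩
  rw [map_smul, Algebra.smul_def, mul_eq_zero] at h0
  refine h0.resolve_left fun h => ?_
  have : ϖ ^ μ = 0 := hinj (by simpa using h)
  exact hϖ.ne_zero (pow_eq_zero_iff'.mp this).1

/-- **The form the lead asked for**: for a non-zero `g ∈ A⟦X⟧` (`A` a complete DVR injecting into the complete
linearly topologised domain `B`), only finitely many `ζ ∈ B` — e.g. the roots of unity of `ℓ`-power order of a finite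
extension, for which `ζ − 1` is topologically nilpotent — have `g(ζ − 1) = 0`. -/
theorem finite_rootsOfUnity_zeros_of_ne_zero (hinj : Function.Injective (algebraMap A B))
    {g : PowerSeries A} (hg : g ≠ 0) :
    {ζ : B | ∃ hζ : HasEval (ζ - 1), aeval hζ g = 0}.Finite := by
  have hfin := finite_zeros_of_ne_zero (B := B) hinj hg
  have hinj' : Function.Injective fun ζ : B => ζ - 1 := sub_left_injective
  refine (hfin.preimage hinj'.injOn).subset ?_
  rintro ζ ⟨hζ, h0⟩
  exact ⟨hζ, h0⟩

end DVR

end PowerSeries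

namespace PowerSeries

section Bound

variable {A : Type*} [CommRing A] [IsLocalRing A] [IsAdicComplete (IsLocalRing.maximalIdeal A) A]
  [UniformSpace A] [IsUniformAddGroup A] [IsTopologicalRing A]
variable {B : Type*} [CommRing B] [IsDomain B] [UniformSpace B] [IsUniformAddGroup B] [T2Space B]
  [CompleteSpace B] [IsTopologicalRing B] [IsLinearTopology B B] [Algebra A B] [ContinuousSMul A B]

/-- **The uniform bound**: the number of topologically nilpotent zeros of `g` in `B` is at most the degree
`λ(g) = natDegree (weierstrassDistinguished g)` of its Weierstrass polynomial — the same bound for EVERY such `B`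
(so «finitely many» is uniform over all finite extensions, as the cofinite quantifier on the `ℓ`-power roots of unity
needs). -/
theorem ncard_zeros_le_natDegree_weierstrassDistinguished (g : PowerSeries A)
    (hg : g.map (IsLocalRing.residue A) ≠ 0) :
    {x : B | ∃ hx : HasEval x, aeval hx g = 0}.ncard ≤ (g.weierstrassDistinguished hg).natDegree := by
  have H := g.isWeierstrassFactorization_weierstrassDistinguished_weierstrassUnit hg
  have hsub : {x : B | ∃ hx : HasEval x, aeval hx g = 0} ⊆ (g.weierstrassDistinguished hg).rootSet B := by
    rintro x ⟨hx, h0⟩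
    rw [Polynomial.mem_rootSet']
    refine ⟨(H.isDistinguishedAt.monic.map (algebraMap A B)).ne_zero, ?_⟩
    have := isRoot_map_of_aeval_eq_zero H.eq_mul H.isUnit hx h0
    rwa [Polynomial.IsRoot.def, Polynomial.eval_map_algebraMap] at this
  exact (Set.ncard_le_ncard hsub (Polynomial.rootSet_finite _ _)).trans
    (Polynomial.ncard_rootSet_le _ _)

end Bound

end PowerSeries

namespace PowerSeries

section Interpolation

variable {A : Type*} [CommRing A] [IsDomain A] [IsDiscreteValuationRing A]
  [IsAdicComplete (IsLocalRing.maximalIdeal A) A] [UniformSpace A] [IsUniformAddGroup A]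
  [IsTopologicalRing A]
variable {B : Type*} [CommRing B] [IsDomain B] [UniformSpace B] [IsUniformAddGroup B] [T2Space B]
  [CompleteSpace B] [IsTopologicalRing B] [IsLinearTopology B B] [Algebra A B] [ContinuousSMul A B]

/-- **The interpolation glue of TIER3.md §1 item 3, steps (3)–(4)**: let `Ξ` index the characters, `ζ ν ∈ B` the
root of unity attached to `ν` (injective, `ζ ν − 1` topologically nilpotent — the dictionary R-B.3), `G ∈ A⟦X⟧` the
branch element and `L ν = u ν · G(ζ ν − 1)` the interpolated value with a non-zero factor `u ν` (the unit Gauss-sum /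
non-vanishing Euler factors of the interpolation formula, R-B.2).  If ONE value `L ν₀` is non-zero, then `L ν = 0` for
only finitely many `ν`.  (The formula `hL` is the printed interpolation formula read as a hypothesis; nothing about
`L`-values is proved here.) -/
theorem finite_vanishing_of_interpolation (hinj : Function.Injective (algebraMap A B)) {Ξ : Type*}
    (ζ : Ξ → B) (hζ : Function.Injective ζ) (hev : ∀ ν, HasEval (ζ ν - 1)) (G : PowerSeries A)
    (L u : Ξ → B) (hu : ∀ ν, u ν ≠ 0) (hL : ∀ ν, L ν = u ν * aeval (hev ν) G) (h0 : ∃ ν₀, L ν₀ ≠ 0) :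
    {ν | L ν = 0}.Finite := by
  obtain ⟨ν₀, hν₀⟩ := h0
  have hG : G ≠ 0 := by
    rintro rfl
    exact hν₀ (by rw [hL, map_zero, mul_zero])
  have hfin := finite_rootsOfUnity_zeros_of_ne_zero (B := B) hinj hG
  refine (hfin.preimage hζ.injOn).subset ?_
  intro ν hν
  refine ⟨hev ν, ?_⟩
  have : u ν * aeval (hev ν) G = 0 := by rw [← hL]; exact hν
  exact (mul_eq_zero.mp this).resolve_left (hu ν)

end Interpolation

end PowerSeries
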